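import Literature.AlgebraicGeometry.Frobenioids.EquivalencePreStepsPerfect
import Literature.AlgebraicGeometry.Frobenioids.EquivalenceThm34iiiOfPreSteps
import Literature.AlgebraicGeometry.Frobenioids.EquivalenceThm34ivvOfThm34iii
import HarnessLib

/-!
# Frobenioids I, Theorem 3.4 (ii), (iii), (iv), (v) AS PRINTED — base categories of FSMFF-type in the
# 2008 sense — for Frobenioids of PERFECT isotropic type

Mochizuki, *The geometry of Frobenioids I: the general theory*, Kyushu J. Math. **62** (2008) 293–400,
Thm. 3.4, kurims pp. 62–63, proof pp. 63–69 [cite: MochizukiFrdI2008, Thm. 3.4 (iii) p.62].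

PROOF-ONLY file (seat abc-iut-w4-d093). Assembly of three landed pieces:
* `FrdI.thm34ii_ofFunctor_of_isOfPerfectType` / `isPreStep_map_of_isOfPerfectType` /
  `isGroupLikeObj_map_of_isOfPerfectType` (this seat, `EquivalencePreStepsPerfect.lean`): Thm. 3.4 (ii) for
  Frobenioids of perfect isotropic type over bases of FSMFF-type AS PRINTED (no revised condition (b));
* `FrdI.OfPreSteps.thm34iii_ofFunctor` (abc-iut-L1-t11): (ii) for `Ψ`, `Ψ⁻¹` ⟹ the typed (iii), NO base
  hypothesis;
* `FrdI.thm34iv_ofFunctor_of_thm34ii_thm34iii`, `FrdI.thm34v_ofFunctor_of_thm34iii` (abc-iut-w4-d088): typed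
  (ii)+(iii) ⟹ typed (iv); typed (iii) ⟹ typed (v); NO base hypothesis.
Hence, for every pair of Frobenioids of PERFECT and ISOTROPIC type and every equivalence `Ψ`, the typed
statements `PreFrobenioidData.Thm34iii`, `Thm34iv`, `Thm34v` (abc-iut-L1-t3) hold at `ofFunctor` — their
hypothesis (a) "standard type" supplies, through its clause (d), exactly the PRINTED 2008 base hypothesis
"`D_i` of FSMFF-type", which is what the (ii)-input consumes here. So in the perfect isotropic case — the
`FrdI.T42.Setting` of the cell's Thm. 4.2 / Thm. 4.9 chain — [FrdI] Thm. 3.4 (ii)–(v) are kernel theorems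
in the printed generality; the cell's earlier closures needed bases of FSM-type (abc-iut-L1-t13 / w4-d033 /
w4-d093 gen 0) or of FSMFF-type in the revised 2024 sense (abc-iut-L1-t11 / w4-d088). Outside perfect
isotropic type the printed-2008 generality of (ii)–(v) remains as recorded in GAP-LEDGER G-L1d8-1.
No new definition; no statement of the paper is strengthened; nothing here bears on [IUTchIII].
-/

namespace Literature.AlgebraicGeometry.Frobenioids

namespace FrdI

open CategoryTheory PreFrobenioidData

universe w v v' u u'

variable {D₁ : Type u} [Category.{v} D₁] {Φ₁ : D₁ᵒᵖ ⥤ CommMonCat.{w}} {C₁ : Type u'} [Category.{v'} C₁]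
  {D₂ : Type u} [Category.{v} D₂] {Φ₂ : D₂ᵒᵖ ⥤ CommMonCat.{w}} {C₂ : Type u'} [Category.{v'} C₂]
  {F₁ : C₁ ⥤ ElemFrobenioid Φ₁} {F₂ : C₂ ⥤ ElemFrobenioid Φ₂}

/-- **[FrdI] Thm. 3.4 (iii) AS TYPED (`PreFrobenioidData.Thm34iii`) holds for every pair of Frobenioids
of PERFECT isotropic type and every equivalence `Ψ`, with the PRINTED (2008) base hypothesis** — read off
clause (d) of hypothesis (a) "standard type": (a), (b) `HypB` ⟹ the seven preservation clauses and the
automorphism `Ψ^{ℕ≥1}` (identity when non-group-like objects exist). Thm. 3.4 (ii) enters through the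
perfect-type route (`isPreStep_map_of_isOfPerfectType`, Prop. 1.14 (ii) without (iii)).
[cite: MochizukiFrdI2008, Thm. 3.4 (iii) p.62] -/
theorem thm34iii_ofFunctor_of_isOfPerfectType (hF₁ : PreFrobenioid.IsFrobenioid F₁)
    (hF₂ : PreFrobenioid.IsFrobenioid F₂) (hist₁ : PreFrobenioid.IsOfIsotropicType F₁)
    (hist₂ : PreFrobenioid.IsOfIsotropicType F₂) (hperf₁ : PreFrobenioid.IsOfPerfectType F₁)
    (hperf₂ : PreFrobenioid.IsOfPerfectType F₂) (Ψ : C₁ ≌ C₂) :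
    (ofFunctor Φ₁ F₁).Thm34iii (ofFunctor Φ₂ F₂) Ψ := fun hs₁ hs₂ hB =>
  OfPreSteps.thm34iii_ofFunctor hF₁ hF₂ Ψ
    (fun _ _ _ hφ => isPreStep_map_of_isOfPerfectType hF₁ hF₂ hist₁ hist₂ hperf₁ hs₂.fsmff Ψ hφ)
    (fun _ _ _ hφ => isPreStep_map_of_isOfPerfectType hF₂ hF₁ hist₂ hist₁ hperf₂ hs₁.fsmff Ψ.symm hφ)
    (fun _ hA => isGroupLikeObj_map_of_isOfPerfectType hF₁ hF₂ hist₁ hist₂ hperf₂ hs₁.fsmff Ψ hA)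
    (fun _ hA => isGroupLikeObj_map_of_isOfPerfectType hF₂ hF₁ hist₂ hist₁ hperf₁ hs₂.fsmff Ψ.symm hA)
    hs₁ hs₂ hB

/-- The same for `Ψ⁻¹`. [cite: MochizukiFrdI2008, Thm. 3.4 (iii) p.62] -/
theorem thm34iii_ofFunctor_symm_of_isOfPerfectType (hF₁ : PreFrobenioid.IsFrobenioid F₁)
    (hF₂ : PreFrobenioid.IsFrobenioid F₂) (hist₁ : PreFrobenioid.IsOfIsotropicType F₁)
    (hist₂ : PreFrobenioid.IsOfIsotropicType F₂) (hperf₁ : PreFrobenioid.IsOfPerfectType F₁)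
    (hperf₂ : PreFrobenioid.IsOfPerfectType F₂) (Ψ : C₁ ≌ C₂) :
    (ofFunctor Φ₂ F₂).Thm34iii (ofFunctor Φ₁ F₁) Ψ.symm :=
  thm34iii_ofFunctor_of_isOfPerfectType hF₂ hF₁ hist₂ hist₁ hperf₂ hperf₁ Ψ.symm

/-- **[FrdI] Thm. 3.4 (iv), preservation part AS TYPED (`PreFrobenioidData.Thm34iv`), for Frobenioids of
PERFECT isotropic type, printed base hypothesis**: under (a), (b), (c) `Ψ` preserves `O^▷(−)`, `O^×(−)` and
Frobenius degrees. [cite: MochizukiFrdI2008, Thm. 3.4 (iv) p.63] -/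
theorem thm34iv_ofFunctor_of_isOfPerfectType (hF₁ : PreFrobenioid.IsFrobenioid F₁)
    (hF₂ : PreFrobenioid.IsFrobenioid F₂) (hist₁ : PreFrobenioid.IsOfIsotropicType F₁)
    (hist₂ : PreFrobenioid.IsOfIsotropicType F₂) (hperf₁ : PreFrobenioid.IsOfPerfectType F₁)
    (hperf₂ : PreFrobenioid.IsOfPerfectType F₂) (Ψ : C₁ ≌ C₂) :
    (ofFunctor Φ₁ F₁).Thm34iv (ofFunctor Φ₂ F₂) Ψ :=
  thm34iv_ofFunctor_of_thm34ii_thm34iii hF₁ hF₂ Ψ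
    (thm34ii_ofFunctor_of_isOfPerfectType hF₁ hF₂ hist₁ hist₂ hperf₁ hperf₂ Ψ)
    (thm34ii_ofFunctor_symm_of_isOfPerfectType hF₁ hF₂ hist₁ hist₂ hperf₁ hperf₂ Ψ)
    (thm34iii_ofFunctor_of_isOfPerfectType hF₁ hF₂ hist₁ hist₂ hperf₁ hperf₂ Ψ)
    (thm34iii_ofFunctor_symm_of_isOfPerfectType hF₁ hF₂ hist₁ hist₂ hperf₁ hperf₂ Ψ)

/-- **[FrdI] Thm. 3.4 (v) AS TYPED (`PreFrobenioidData.Thm34v`), for Frobenioids of PERFECT isotropic type,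
printed base hypothesis**: under (a), (b), (c) slim bases, `Ψ` preserves base-identity endomorphisms and
base-equivalent pairs, and `Ψ^Base : D₁ ⥲ D₂` exists `1`-uniquely with rigid composites.
[cite: MochizukiFrdI2008, Thm. 3.4 (v) p.63] -/
theorem thm34v_ofFunctor_of_isOfPerfectType (hF₁ : PreFrobenioid.IsFrobenioid F₁)
    (hF₂ : PreFrobenioid.IsFrobenioid F₂) (hist₁ : PreFrobenioid.IsOfIsotropicType F₁)
    (hist₂ : PreFrobenioid.IsOfIsotropicType F₂) (hperf₁ : PreFrobenioid.IsOfPerfectType F₁)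
    (hperf₂ : PreFrobenioid.IsOfPerfectType F₂) (Ψ : C₁ ≌ C₂) :
    (ofFunctor Φ₁ F₁).Thm34v (ofFunctor Φ₂ F₂) Ψ :=
  thm34v_ofFunctor_of_thm34iii hF₁ hF₂ Ψ
    (thm34iii_ofFunctor_of_isOfPerfectType hF₁ hF₂ hist₁ hist₂ hperf₁ hperf₂ Ψ)
    (thm34iii_ofFunctor_symm_of_isOfPerfectType hF₁ hF₂ hist₁ hist₂ hperf₁ hperf₂ Ψ)

end FrdI

end Literature.AlgebraicGeometry.Frobenioids
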